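import Literature.Analysis.OperatorTheory.KreinLangerDefinitization
import Literature.Analysis.OperatorTheory.KreinStewartTranslationForm

/-!
# KreinLangerDefinitization — proofs

Discharge of the named fact `Literature.Analysis.OperatorTheory.KreinDefinitization`
(Kreĭn 1959; J. Stewart, Canad. Math. Bull. 15 (1972), Thm. 3.1 with Thm. 2.4; read from the
paper, doi:10.4153/cmb-1972-073-9, pp. 403–404).

Proof (architecture of Stewart's proof of Thm. 3.1, made elementary): the translation-invariant
form `BF F` of `F` on point masses has at most `κ` negative squares (hypothesis); for each `η > 0`
the symmetric operator `SDOp η = (2iη)⁻¹ (U η - U (-η))` is definitized by a polynomial `P_η` of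
degree `≤ κ` with coefficient vector on the unit sphere (`KreinStewart.abs_definitization`, which
replaces "Pontryagin space + Naimark extension + Pontryagin's invariant subspace + `Q(A')L = 0 ⇒
ran Q̄(A') ⊆ L^⊥ ≥ 0`" by finite-dimensional compressions and compactness); along `η = 1/(r+1)` a
subsequence of coefficient vectors converges, and the matrix entries
`BF δ_s ((SDOp η)^N δ_t) → (-i)^N F^{(N)}(t - s)` (`KreinStewart.tendsto_BF_single_SDOp_pow`), so the
limit polynomial `P` satisfies the pointwise positivity of the kernel `P(-iD) P♯(-iD) F` claimed by
`KreinDefinitization`.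
-/

open scoped ComplexConjugate ContDiff
open Module Polynomial Filter
open _root_.Topology

namespace Literature.Analysis.OperatorTheory.KreinStewart

/-- **Kreĭn–Stewart definitization, pointwise smooth form** (the statement of the tree's
`KreinDefinitization`). [cite: Stewart1972, Thm. 3.1 with Thm. 2.4] -/
theorem kreinDefinitization_main (κ : ℕ) (F : ℝ → ℂ)
    (hF : ContDiff ℝ ((⊤ : ℕ∞) : WithTop ℕ∞) F) (hFs : ∀ x, F (-x) = conj (F x))
    (H : ∀ (n : ℕ) (x : Fin n → ℝ) (v : Fin (κ + 1) → Fin n → ℂ), ∃ w : Fin (κ + 1) → ℂ, w ≠ 0 ∧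
      0 ≤ (∑ k, ∑ l, (∑ i, w i * v i k) * conj (∑ i, w i * v i l) * F (x k - x l)).re) :
    ∃ P : Polynomial ℂ, P ≠ 0 ∧ P.natDegree ≤ κ ∧
      ∀ (n : ℕ) (x : Fin n → ℝ) (c : Fin n → ℂ),
        0 ≤ (∑ k, ∑ l, c k * conj (c l) *
          ∑ j ∈ Finset.range (P.natDegree + 1), ∑ m ∈ Finset.range (P.natDegree + 1),
            P.coeff j * conj (P.coeff m) * (-Complex.I) ^ (j + m) *
              iteratedDeriv (j + m) F (x k - x l)).re := by
  classical
  have hB : (BF F).IsSymm := isSymm_BF hFs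
  have hneg : NegSqLE (BF F) κ := negSqLE_BF F κ H
  set η : ℕ → ℝ := fun r => 1 / ((r : ℝ) + 1) with hηdef
  have hη : ∀ r, 0 < η r := fun r => by rw [hηdef]; positivity
  have hη0 : Tendsto η atTop (𝓝 0) := tendsto_one_div_add_atTop_nhds_zero_nat
  have step : ∀ r, ∃ c : Fin (κ + 1) → ℂ, c ∈ Metric.sphere (0 : Fin (κ + 1) → ℂ) 1 ∧
      ∀ v, 0 ≤ (BF F (aeval (SDOp (η r)) (toPoly c) v) (aeval (SDOp (η r)) (toPoly c) v)).re :=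
    fun r => abs_definitization_sphere hB (isSymOp_SDOp F (η r)) hneg
  choose cs hcsS hcs using step
  obtain ⟨a, haS, φ, hφ, hlim⟩ :=
    (isCompact_sphere (0 : Fin (κ + 1) → ℂ) 1).tendsto_subseq hcsS
  have ha0 : a ≠ 0 := by
    intro h0
    rw [h0, mem_sphere_zero_iff_norm, norm_zero] at haS
    exact zero_ne_one haS
  refine ⟨toPoly a, fun h0 => ha0 ((toPoly_eq_zero_iff a).1 h0), natDegree_toPoly_le a,
    fun n x c => ?_⟩
  -- rewrite the target with the coefficient vector `a`
  have htarget : (∑ k, ∑ l, c k * conj (c l) *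
      ∑ j ∈ Finset.range ((toPoly a).natDegree + 1),
        ∑ m ∈ Finset.range ((toPoly a).natDegree + 1),
          (toPoly a).coeff j * conj ((toPoly a).coeff m) * (-Complex.I) ^ (j + m) *
            iteratedDeriv (j + m) F (x k - x l))
      = ∑ k, ∑ l, c k * conj (c l) * ∑ j : Fin (κ + 1), ∑ m : Fin (κ + 1),
          a j * conj (a m) * ((-Complex.I) ^ ((j : ℕ) + (m : ℕ)) *
            iteratedDeriv (j + m) F (x k - x l)) := by
    refine Finset.sum_congr rfl fun k _ => Finset.sum_congr rfl fun l _ => ?_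
    rw [coeff_sum_toPoly a (fun N => iteratedDeriv N F (x k - x l))]
    congr 1
    refine Finset.sum_congr rfl fun j _ => Finset.sum_congr rfl fun m _ => ?_
    ring
  rw [htarget]
  -- the approximating quantities
  set v : ℝ →₀ ℂ := ∑ k, c k • Finsupp.single (x k) 1 with hvdef
  set G : ℕ → ℕ → Fin n → Fin n → ℂ := fun r N k l =>
    BF F (Finsupp.single (x l) 1) ((SDOp (η r) ^ N) (Finsupp.single (x k) 1)) with hGdef
  have hQ : ∀ r, BF F (aeval (SDOp (η r)) (toPoly (cs r)) v) (aeval (SDOp (η r)) (toPoly (cs r)) v)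
      = ∑ k, ∑ l, c k * conj (c l) * ∑ j : Fin (κ + 1), ∑ m : Fin (κ + 1),
          cs r j * conj (cs r m) * G r (j + m) k l := by
    intro r
    rw [hvdef, apply_lin_sum_swap]
    refine Finset.sum_congr rfl fun k _ => Finset.sum_congr rfl fun l _ => ?_
    rw [apply_aeval_toPoly₂ (isSymOp_SDOp F (η r))]
  -- limits along the subsequence
  have hηφ : ∀ r, 0 < η (φ r) := fun r => hη (φ r)
  have hηφ0 : Tendsto (fun r => η (φ r)) atTop (𝓝 0) := hη0.comp hφ.tendsto_atTop
  have hGlim : ∀ (N : ℕ) (k l : Fin n), Tendsto (fun r => G (φ r) N k l) atTop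
      (𝓝 ((-Complex.I) ^ N * iteratedDeriv N F (x k - x l))) := fun N k l =>
    tendsto_BF_single_SDOp_pow hF N (x l) (x k) hηφ hηφ0
  have hclim : ∀ j, Tendsto (fun r => cs (φ r) j) atTop (𝓝 (a j)) := fun j =>
    (continuous_apply j).continuousAt.tendsto.comp hlim
  have hclim' : ∀ m, Tendsto (fun r => conj (cs (φ r) m)) atTop (𝓝 (conj (a m))) := fun m =>
    (Complex.continuous_conj.tendsto (a m)).comp (hclim m)
  have hsum : Tendsto (fun r => ∑ k, ∑ l, c k * conj (c l) * ∑ j : Fin (κ + 1), ∑ m : Fin (κ + 1),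
      cs (φ r) j * conj (cs (φ r) m) * G (φ r) (j + m) k l) atTop
      (𝓝 (∑ k, ∑ l, c k * conj (c l) * ∑ j : Fin (κ + 1), ∑ m : Fin (κ + 1),
        a j * conj (a m) * ((-Complex.I) ^ ((j : ℕ) + (m : ℕ)) *
          iteratedDeriv (j + m) F (x k - x l)))) := by
    refine tendsto_finsetSum _ fun k _ => tendsto_finsetSum _ fun l _ => ?_
    refine Tendsto.const_mul _ ?_
    refine tendsto_finsetSum _ fun j _ => tendsto_finsetSum _ fun m _ => ?_
    exact ((hclim j).mul (hclim' m)).mul (hGlim _ k l)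
  have hre := (Complex.continuous_re.tendsto _).comp hsum
  refine ge_of_tendsto' hre fun r => ?_
  have := hcs (φ r) v
  rw [hQ] at this
  exact this

end Literature.Analysis.OperatorTheory.KreinStewart

namespace Literature.Analysis.OperatorTheory

/-- **Discharge of `KreinDefinitization`** (Kreĭn 1959; Stewart 1972, Thm. 3.1 with Thm. 2.4):
proved by an elementary finite-dimensional compression + compactness argument
(`KreinStewart.abs_definitization`) applied to the symmetric difference-quotient operators
`KreinStewart.SDOp η` on point masses, followed by the limit `η → 0⁺`.
[cite: Stewart1972, Thm. 3.1 with Thm. 2.4] -/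
theorem KreinDefinitization_holds : KreinDefinitization :=
  fun κ F hF hFs H => KreinStewart.kreinDefinitization_main κ F hF hFs H

end Literature.Analysis.OperatorTheory
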